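import Mathlib
import Literature.NumberTheory.Transcendental.MZVSimplexRep
import Literature.NumberTheory.Transcendental.MultipleZetaStuffle

/-!
# `StuffleInKZ` (stmt-KontsevichZagierPeriods-3931, route `FurushoPentagon`) — line
`cumulative-cube-lattice-paths`: the combinatorial objects of the cube lever

Route-posited objects (D-0016: `<RouteSlug>…Defs.lean`) used by the line that proves the stuffle
(harmonic product) relations `[Δ_s]·[Δ_t] − Σ_{u ∈ s∗t} [Δ_u] ∈ KZ.relations` inside the
Kontsevich–Zagier calculus by the CUBE LEVER (idea card
`Cruxes/StuffleInKZ/Ideas/cumulative-cube-lattice-paths.md`; Soudères 2010 Prop. 1.5, Markarian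
2020 Prop. 2):

* `Step`, `paths k l` — lattice paths from `(0,0)` to `(k,l)` with steps `X = (1,0)`,
  `Y = (0,1)`, `D = (1,1)` (a tie), enumerated in the order of Hoffman's head recursion
  (A1)–(A3) of `MZV.stuffle`; `cx p`, `cy p` — the endpoint of a step list;
* `merge p s t` — the index of `s ∗ t` produced along the path `p` (so that
  `MZV.stuffle s t = (paths |s| |t|).map (merge · s t)`, an ORDERED-list identity);
  `interleave p s t xs ys` — the corresponding block interleaving of coordinate lists;
* `openCube n = (0,1)ⁿ`;
* `cubeKernel u ws = ∏_{m<|u|} q_m / (1 − q_{m+1})`, `q_m = (ws.take (u₁+⋯+u_m)).prod` — the pull-back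
  of Kontsevich's simplex integrand of `ζ(u)` along the chart `tᵢ = x₀⋯xᵢ` of the open cube
  (coordinates as a `List ℝ`, so that block interleaving is list surgery);
* `nodeProd`, `pathKernel s t p xs ys = ∏_{m<|p|} N_m / (1 − N_{m+1})`, `N_m = A_{i_m}(xs)·B_{j_m}(ys)`
  the node products along `p` — the summand of the kernel identity
  `cubeKernel s xs · cubeKernel t ys = Σ_{p ∈ paths} pathKernel s t p xs ys`;
* `chart w x i = ∏_{j ≤ i} x j` — the cumulative-product chart `(0,1)ʷ → {1 > t₀ > ⋯ > t_{w-1} > 0}`.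

Only definitions, their unfolding (`rfl`/`simp`) lemmas and the enumeration stub `stub_enumeration`
(`MZV.stuffle s t = (paths |s| |t|).map (merge · s t)`) live here; every other statement of the line
is a theorem in the sibling `FurushoPentagonStuffleInKZ*.lean` files.

References: M. Hoffman, J. Algebra 194 (1997) §2; I. Soudères, *Motivic double shuffle*,
IJNT 6 (2010) §1.3; N. Markarian, arXiv:2008.00855, Prop. 2; M. Kontsevich, D. Zagier,
*Periods* (2001) §1.2.
-/

noncomputable section

namespace Summit.KontsevichZagierPeriods.FurushoPentagon.StuffleInKZ

open Literature.NumberTheory.Transcendental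

/-! ## Lattice paths -/

/-- A step of a lattice path in the stuffle square: `X` consumes the next entry of `s` alone,
`Y` the next entry of `t` alone, `D` (diagonal, a "tie" `nᵢ = mⱼ`) both, merged.
[cite: Hoffman1997, §2 (A3)] -/
inductive Step : Type
  | X : Step
  | Y : Step
  | D : Step
  deriving DecidableEq, Repr, Inhabited

/-- The lattice paths from `(0,0)` to `(k,l)` as step lists, enumerated in the order of Hoffman's
head recursion for `MZV.stuffle` (`(a s)∗(b t) = a(s∗bt) + b(as∗t) + (a+b)(s∗t)`): first step
`X`, then `Y`, then `D`. [cite: Hoffman1997, §2 (A1)–(A3)] -/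
def paths : ℕ → ℕ → List (List Step)
  | 0, l => [List.replicate l Step.Y]
  | k + 1, 0 => [List.replicate (k + 1) Step.X]
  | k + 1, l + 1 =>
      (paths k (l + 1)).map (List.cons Step.X) ++
        ((paths (k + 1) l).map (List.cons Step.Y) ++ (paths k l).map (List.cons Step.D))

/-- The number of entries of `s` consumed by a step list (`X` and `D` steps). [folklore] -/
def cx (p : List Step) : ℕ := p.count Step.X + p.count Step.D

/-- The number of entries of `t` consumed by a step list (`Y` and `D` steps). [folklore] -/
def cy (p : List Step) : ℕ := p.count Step.Y + p.count Step.D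

/-- The index of the harmonic product `s ∗ t` produced along a step list: `X` copies the next entry
of `s`, `Y` the next entry of `t`, `D` their sum; the result is truncated when a list runs out.
[cite: Hoffman1997, §2 (A3)] -/
def merge : List Step → List ℕ → List ℕ → List ℕ
  | Step.X :: p, a :: s, t => a :: merge p s t
  | Step.Y :: p, s, b :: t => b :: merge p s t
  | Step.D :: p, a :: s, b :: t => (a + b) :: merge p s t
  | _, _, _ => []

/-! ### Unfolding lemmas -/

/-- `paths 0 l` is the single all-`Y` path. [folklore] -/
@[simp] theorem paths_zero_left (l : ℕ) : paths 0 l = [List.replicate l Step.Y] := by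
  simp [paths]

/-- `paths (k+1) 0` is the single all-`X` path. [folklore] -/
@[simp] theorem paths_succ_zero (k : ℕ) : paths (k + 1) 0 = [List.replicate (k + 1) Step.X] := by
  simp [paths]

/-- `paths k 0` is the single all-`X` path. [folklore] -/
theorem paths_zero_right (k : ℕ) : paths k 0 = [List.replicate k Step.X] := by
  cases k <;> simp

/-- Hoffman's recursion for the path enumeration. [cite: Hoffman1997, §2 (A3)] -/
theorem paths_succ_succ (k l : ℕ) :
    paths (k + 1) (l + 1) =
      (paths k (l + 1)).map (List.cons Step.X) ++
        ((paths (k + 1) l).map (List.cons Step.Y) ++ (paths k l).map (List.cons Step.D)) := by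
  simp [paths]

/-- `merge` along the empty path. [folklore] -/
@[simp] theorem merge_nil (s t : List ℕ) : merge [] s t = [] := by
  cases s <;> cases t <;> rfl

/-- `merge` of an `X` step. [folklore] -/
@[simp] theorem merge_X_cons (p : List Step) (a : ℕ) (s t : List ℕ) :
    merge (Step.X :: p) (a :: s) t = a :: merge p s t := rfl

/-- `merge` of a `Y` step. [folklore] -/
@[simp] theorem merge_Y_cons (p : List Step) (s : List ℕ) (b : ℕ) (t : List ℕ) :
    merge (Step.Y :: p) s (b :: t) = b :: merge p s t := by
  cases s <;> rfl

/-- `merge` of a `D` step. [folklore] -/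
@[simp] theorem merge_D_cons (p : List Step) (a : ℕ) (s : List ℕ) (b : ℕ) (t : List ℕ) :
    merge (Step.D :: p) (a :: s) (b :: t) = (a + b) :: merge p s t := rfl

/-- `merge` of an `X` step with `s` exhausted. [folklore] -/
@[simp] theorem merge_X_nil (p : List Step) (t : List ℕ) : merge (Step.X :: p) [] t = [] := rfl

/-- `merge` of a `Y` step with `t` exhausted. [folklore] -/
@[simp] theorem merge_Y_nil (p : List Step) (s : List ℕ) : merge (Step.Y :: p) s [] = [] := by
  cases s <;> rfl

/-- `merge` of a `D` step with `s` exhausted. [folklore] -/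
@[simp] theorem merge_D_nil_left (p : List Step) (t : List ℕ) : merge (Step.D :: p) [] t = [] := by
  cases t <;> rfl

/-- `merge` of a `D` step with `t` exhausted. [folklore] -/
@[simp] theorem merge_D_nil_right (p : List Step) (s : List ℕ) : merge (Step.D :: p) s [] = [] := by
  cases s <;> rfl

/-- `cx []  = 0`. [folklore] -/
@[simp] theorem cx_nil : cx [] = 0 := rfl
/-- `cy []  = 0`. [folklore] -/
@[simp] theorem cy_nil : cy [] = 0 := rfl
/-- `cx` of an `X` step. [folklore] -/
@[simp] theorem cx_cons_X (p : List Step) : cx (Step.X :: p) = cx p + 1 := by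
  simp [cx]; omega
/-- `cx` of a `Y` step. [folklore] -/
@[simp] theorem cx_cons_Y (p : List Step) : cx (Step.Y :: p) = cx p := by simp [cx]
/-- `cx` of a `D` step. [folklore] -/
@[simp] theorem cx_cons_D (p : List Step) : cx (Step.D :: p) = cx p + 1 := by
  simp [cx]; omega
/-- `cy` of an `X` step. [folklore] -/
@[simp] theorem cy_cons_X (p : List Step) : cy (Step.X :: p) = cy p := by simp [cy]
/-- `cy` of a `Y` step. [folklore] -/
@[simp] theorem cy_cons_Y (p : List Step) : cy (Step.Y :: p) = cy p + 1 := by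
  simp [cy]; omega
/-- `cy` of a `D` step. [folklore] -/
@[simp] theorem cy_cons_D (p : List Step) : cy (Step.D :: p) = cy p + 1 := by
  simp [cy]; omega
/-- `cx` is additive under concatenation. [folklore] -/
@[simp] theorem cx_append (p q : List Step) : cx (p ++ q) = cx p + cx q := by
  simp [cx]; omega
/-- `cy` is additive under concatenation. [folklore] -/
@[simp] theorem cy_append (p q : List Step) : cy (p ++ q) = cy p + cy q := by
  simp [cy]; omega

/-- **Block interleaving** of two coordinate lists along a step list: `X` moves the next block of
`xs` (of length the next entry of `s`), `Y` the next block of `ys`, `D` both (the `xs`-block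
first); truncated when an index list runs out. The cube kernel of `merge p s t` at
`interleave p s t xs ys` is the path kernel `pathKernel s t p xs ys`. [folklore] -/
def interleave {α : Type*} : List Step → List ℕ → List ℕ → List α → List α → List α
  | Step.X :: p, a :: s, t, xs, ys => xs.take a ++ interleave p s t (xs.drop a) ys
  | Step.Y :: p, s, b :: t, xs, ys => ys.take b ++ interleave p s t xs (ys.drop b)
  | Step.D :: p, a :: s, b :: t, xs, ys =>
      xs.take a ++ (ys.take b ++ interleave p s t (xs.drop a) (ys.drop b))
  | _, _, _, _, _ => []

/-- `interleave` along the empty path. [folklore] -/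
@[simp] theorem interleave_nil {α : Type*} (s t : List ℕ) (xs ys : List α) :
    interleave [] s t xs ys = [] := by
  cases s <;> cases t <;> rfl

/-- `interleave` of an `X` step. [folklore] -/
@[simp] theorem interleave_X_cons {α : Type*} (p : List Step) (a : ℕ) (s t : List ℕ) (xs ys : List α) :
    interleave (Step.X :: p) (a :: s) t xs ys = xs.take a ++ interleave p s t (xs.drop a) ys := rfl

/-- `interleave` of a `Y` step. [folklore] -/
@[simp] theorem interleave_Y_cons {α : Type*} (p : List Step) (s : List ℕ) (b : ℕ) (t : List ℕ)
    (xs ys : List α) :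
    interleave (Step.Y :: p) s (b :: t) xs ys = ys.take b ++ interleave p s t xs (ys.drop b) := by
  cases s <;> rfl

/-- `interleave` of a `D` step. [folklore] -/
@[simp] theorem interleave_D_cons {α : Type*} (p : List Step) (a : ℕ) (s : List ℕ) (b : ℕ) (t : List ℕ)
    (xs ys : List α) :
    interleave (Step.D :: p) (a :: s) (b :: t) xs ys =
      xs.take a ++ (ys.take b ++ interleave p s t (xs.drop a) (ys.drop b)) := rfl

/-- `interleave` of an `X` step with `s` exhausted. [folklore] -/
@[simp] theorem interleave_X_nil {α : Type*} (p : List Step) (t : List ℕ) (xs ys : List α) :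
    interleave (Step.X :: p) [] t xs ys = [] := rfl

/-- `interleave` of a `Y` step with `t` exhausted. [folklore] -/
@[simp] theorem interleave_Y_nil {α : Type*} (p : List Step) (s : List ℕ) (xs ys : List α) :
    interleave (Step.Y :: p) s [] xs ys = [] := by
  cases s <;> rfl

/-- `interleave` of a `D` step with `s` exhausted. [folklore] -/
@[simp] theorem interleave_D_nil_left {α : Type*} (p : List Step) (t : List ℕ) (xs ys : List α) :
    interleave (Step.D :: p) [] t xs ys = [] := by
  cases t <;> rfl

/-- `interleave` of a `D` step with `t` exhausted. [folklore] -/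
@[simp] theorem interleave_D_nil_right {α : Type*} (p : List Step) (s : List ℕ) (xs ys : List α) :
    interleave (Step.D :: p) s [] xs ys = [] := by
  cases s <;> rfl

/-! ## The open cube and the kernels -/

/-- The open unit cube `(0,1)ⁿ ⊆ ℝⁿ`. [folklore] -/
def openCube (n : ℕ) : Set (Fin n → ℝ) := {x | ∀ i, x i ∈ Set.Ioo (0 : ℝ) 1}

/-- Membership in the open cube. [folklore] -/
@[simp] theorem mem_openCube {n : ℕ} {x : Fin n → ℝ} : x ∈ openCube n ↔ ∀ i, x i ∈ Set.Ioo (0 : ℝ) 1 :=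
  Iff.rfl

/-- **The cube kernel** of an index `u = (u₁,…,u_k)` at a coordinate list `ws` (intended length
`weight u`): `∏_{m<k} q_m / (1 − q_{m+1})` with `q_m = (ws.take (u₁+⋯+u_m)).prod` the partial
product up to the `m`-th cumulative position (`q_0 = 1`). It is the pull-back of Kontsevich's
integrand `∏ ω_{εᵢ}(tᵢ)` of `ζ(u)` along the chart `tᵢ = x₀⋯xᵢ`, times its Jacobian; e.g.
`cubeKernel [2] [x,y] = 1/(1 − xy)`, `cubeKernel [2,2] [x,y,z,w] = (1/(1−xy))·(xy/(1−xyzw))`.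
[cite: Souderes2010, §1.3 Prop. 1.3] -/
def cubeKernel (u : List ℕ) (ws : List ℝ) : ℝ :=
  ∏ m ∈ Finset.range u.length,
    (ws.take (u.take m).sum).prod / (1 - (ws.take (u.take (m + 1)).sum).prod)

/-- The node product after `m` steps of the path `p`: `A_{i_m}(xs) · B_{j_m}(ys)` where
`(i_m, j_m) = (cx, cy) (p.take m)` and `A_i(xs) = (xs.take (s₁+⋯+s_i)).prod`,
`B_j(ys) = (ys.take (t₁+⋯+t_j)).prod`. [cite: Souderes2010, §1.3 Prop. 1.5] -/
def nodeProd (s t : List ℕ) (p : List Step) (xs ys : List ℝ) (m : ℕ) : ℝ :=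
  (xs.take (s.take (cx (p.take m))).sum).prod * (ys.take (t.take (cy (p.take m))).sum).prod

/-- **The path kernel**: the summand of the cube kernel identity attached to the lattice path `p`,
`∏_{m<|p|} N_m / (1 − N_{m+1})` with `N_m = nodeProd s t p xs ys m` (`N_0 = 1`); it is the cube
kernel of `merge p s t` at the block-interleaved coordinates. [cite: Souderes2010, §1.3 Prop. 1.5] -/
def pathKernel (s t : List ℕ) (p : List Step) (xs ys : List ℝ) : ℝ :=
  ∏ m ∈ Finset.range p.length, nodeProd s t p xs ys m / (1 - nodeProd s t p xs ys (m + 1))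

/-- **The cumulative-product chart** `Φ(x)ᵢ = ∏_{j ≤ i} x_j` of `ℝʷ`, mapping the open cube
`(0,1)ʷ` bijectively onto Kontsevich's open ordered simplex `1 > t₀ > ⋯ > t_{w−1} > 0`
(inverse `x₀ = t₀`, `xᵢ = tᵢ / t_{i−1}`), with lower-triangular Jacobian of determinant
`∏ᵢ ∏_{j<i} x_j`. [cite: Souderes2010, §1.3] -/
def chart (w : ℕ) (x : Fin w → ℝ) (i : Fin w) : ℝ :=
  ∏ j ∈ Finset.univ.filter (fun j : Fin w => j ≤ i), x j

/-! ### Unfolding lemmas and sanity checks -/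

/-- The cube kernel, unfolded. [folklore] -/
theorem cubeKernel_def (u : List ℕ) (ws : List ℝ) : cubeKernel u ws =
    ∏ m ∈ Finset.range u.length,
      (ws.take (u.take m).sum).prod / (1 - (ws.take (u.take (m + 1)).sum).prod) := rfl

/-- The path kernel, unfolded. [folklore] -/
theorem pathKernel_def (s t : List ℕ) (p : List Step) (xs ys : List ℝ) : pathKernel s t p xs ys =
    ∏ m ∈ Finset.range p.length,
      nodeProd s t p xs ys m / (1 - nodeProd s t p xs ys (m + 1)) := rfl

/-- The node product, unfolded. [folklore] -/
theorem nodeProd_def (s t : List ℕ) (p : List Step) (xs ys : List ℝ) (m : ℕ) :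
    nodeProd s t p xs ys m =
      (xs.take (s.take (cx (p.take m))).sum).prod * (ys.take (t.take (cy (p.take m))).sum).prod :=
  rfl

/-- The chart, unfolded. [folklore] -/
theorem chart_apply (w : ℕ) (x : Fin w → ℝ) (i : Fin w) :
    chart w x i = ∏ j ∈ Finset.univ.filter (fun j : Fin w => j ≤ i), x j := rfl

/-- The cube kernel of the empty index is `1`. [folklore] -/
@[simp] theorem cubeKernel_nil (ws : List ℝ) : cubeKernel [] ws = 1 := by
  simp [cubeKernel]

/-- The path kernel of the empty path is `1`. [folklore] -/
@[simp] theorem pathKernel_nil (s t : List ℕ) (xs ys : List ℝ) : pathKernel s t [] xs ys = 1 := by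
  simp [pathKernel]

/-- The initial node product is `1`. [folklore] -/
@[simp] theorem nodeProd_zero (s t : List ℕ) (p : List Step) (xs ys : List ℝ) :
    nodeProd s t p xs ys 0 = 1 := by
  simp [nodeProd]

/-- Sanity check: `cubeKernel [2] [x, y] = 1 / (1 − x y)`. [folklore] -/
example (x y : ℝ) : cubeKernel [2] [x, y] = 1 / (1 - x * y) := by
  simp [cubeKernel]

/-- Sanity check: `cubeKernel [2,2] [x,y,z,w] = (1/(1−xy)) · (xy/(1−xyzw))`. [folklore] -/
example (x y z w : ℝ) :
    cubeKernel [2, 2] [x, y, z, w] = 1 / (1 - x * y) * (x * y / (1 - x * y * z * w)) := by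
  simp only [cubeKernel, List.length_cons, List.length_nil, Finset.prod_range_succ, Finset.prod_range_zero]
  simp [List.take, List.sum_cons, one_mul, mul_assoc]

/-- Sanity check: the paths to `(1,1)` are `X Y`, `Y X`, `D`, and merging `(a) ∗ (b)` along them
gives Hoffman's `(a,b) + (b,a) + (a+b)` in `MZV.stuffle`'s order. [cite: Hoffman1997, §2 (A3)] -/
example (a b : ℕ) : (paths 1 1).map (fun p => merge p [a] [b]) = MZV.stuffle [a] [b] := by
  simp [paths_succ_succ, MZV.stuffle_cons_cons]

/-- Sanity check: `(2,1) ∗ (3)` along the `5` paths to `(2,1)`, in order, is `MZV.stuffle [2,1] [3]`.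
[cite: Hoffman1997, §2 (A3)] -/
example : (paths 2 1).map (fun p => merge p [2, 1] [3]) = MZV.stuffle [2, 1] [3] := by
  simp [paths_succ_succ, MZV.stuffle_cons_cons]

/-- Sanity check: along the tie path `D`, the blocks are juxtaposed and the cube kernel of the merged
index `(a+b)` is the path kernel `1/(1 − (xs.prod)(ys.prod))`. [folklore] -/
example (x y u v : ℝ) : interleave [Step.D] [2] [2] [x, y] [u, v] = [x, y, u, v] ∧
    cubeKernel (merge [Step.D] [2] [2]) [x, y, u, v] = pathKernel [2] [2] [Step.D] [x, y] [u, v] := by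
  refine ⟨rfl, ?_⟩
  simp [cubeKernel, pathKernel, nodeProd, cx, cy, List.take, mul_assoc]

end Summit.KontsevichZagierPeriods.FurushoPentagon.StuffleInKZ

/-! ## The enumeration stub of the line

`MZV.stuffle s t = (paths |s| |t|).map (merge · s t)` as ORDERED lists (registered stub
`stub_enumeration` of the skeleton `Cruxes/StuffleInKZ/Lines/cumulative-cube-lattice-paths.lean`). -/

namespace Summit.KontsevichZagierPeriods.FurushoPentagon.StuffleInKZ

open Literature.NumberTheory.Transcendental
open Literature.NumberTheory.Transcendental.MZV (stuffle)

/-- Merging along the all-`Y` path with `s` exhausted copies `t`. [folklore] -/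
theorem merge_replicate_Y_nil (t : List ℕ) : merge (List.replicate t.length Step.Y) [] t = t := by
  induction t with
  | nil => simp
  | cons b t ih => simp [List.replicate_succ, ih]

/-- Merging along the all-`X` path with `t` exhausted copies `s`. [folklore] -/
theorem merge_replicate_X_nil (s : List ℕ) : merge (List.replicate s.length Step.X) s [] = s := by
  induction s with
  | nil => simp
  | cons a s ih => simp [List.replicate_succ, ih]

/-- **Stub `stub_enumeration`**: Hoffman's harmonic product, as an ORDERED list, is the list of merged
indices along the lattice paths in head-recursive order:
`MZV.stuffle s t = (paths |s| |t|).map (merge · s t)`. [cite: Hoffman1997, §2 (A1)–(A3)] -/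
theorem stub_enumeration : ∀ s t : List ℕ,
    stuffle s t = (paths s.length t.length).map (fun p => merge p s t) := by
  intro s t
  induction s, t using MZV.stuffle.induct with
  | case1 t => simp [merge_replicate_Y_nil]
  | case2 a s => simpa using (merge_replicate_X_nil (a :: s)).symm
  | case3 a s b t ih1 ih2 ih3 =>
    rw [MZV.stuffle_cons_cons, ih1, ih2, ih3, List.length_cons, List.length_cons, paths_succ_succ]
    simp [List.map_append, List.map_map, Function.comp_def]

end Summit.KontsevichZagierPeriods.FurushoPentagon.StuffleInKZ
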